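import Literature.IUT.HodgeTheaters.PMBaseKitModel
import Literature.IUT.HodgeTheaters.PMBaseModels
import Literature.IUT.HodgeTheaters.PMBaseDischarge

/-!
# [IUTchI] Ex 6.3 (i) / Prop 6.5 (i): the synchronisation law `PhiEllSync` is satisfiable and independent of the base interface

Mochizuki, *Inter-universal Teichmüller theory I*, §6, Example 6.3 (i) pp. 160–161 and Proposition
6.5 (i) pp. 163–164, kurims manuscript (May 2020) [claim: Mochizuki2012, status: disputed]. PROOF-ONLY
companion (theorems, no definitions) to abc-iut-L5-t4's `PMBaseKit.lean` (FROZEN) / `PMBaseKitModel.lean`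
/ `PMBaseModels.lean`, by the wave-4 discharge seat abc-iut-w4-d073 (home layer L5); node ids
IUTchI:Ex6.3(i), IUTchI:Prop6.5(i) (plan/FACT-LIST.md draft rows F-2029 `Ex63.PhiEllSync`, F-2019
`DThetaEllBridge.XiGroupCompat`).

Context. The audit finding R7-L5t4-F1 (abc-iut-L5-t6, 2026-08-25) observed BY INSPECTION that the second
sentence of Prop 6.5 (i) (`DThetaEllBridge.XiGroupCompat`, "the bijection `†ξ^{Θell}_{v_t,w_t}` … is
compatible with the respective `𝔽_l^±`-group structures", p. 164) is not derivable from the frozen interface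
`PMBaseKit`; abc-iut-L5-t4 then named the missing input as the synchronisation law `Ex63.PhiEllSync` of
Example 6.3 (i) ("we obtain a natural bijection `LabCusp^±(†𝒟_v) ⥲ 𝔽_l^±` … well-defined up to
multiplication by `±1`", Def 6.1 (iii) p. 157, read at the model through the FIXED chart of p. 160) and
proved `DThetaEllBridge.xiGroupCompat_of_sync : Ex63.PhiEllSync K → B.XiGroupCompat`
(`PMBaseDischarge.lean`). This file makes the status of that named law KERNEL-CHECKED:

* `Ex63.phiEllSync_toyKit` — the law HOLDS for abc-iut-L5-t4's consistency model `PMBaseKit.toyKit`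
  (so the hypothesis of `xiGroupCompat_of_sync` is satisfiable together with every interface clause);
* `Ex63.exists_kit_not_phiEllSync` — for every prime `l ≠ 2` there is a kit (the same toy collage kit with
  `φ^{Θell}_{•,v}` replaced by the TRANSLATION `z ↦ z + 1` of `AGL₁(𝔽_l)`, exactly the kit of
  abc-iut-L5-t13's `Ex63.exists_kit_not_equivariant`; all interface clauses still hold) over which the law
  FAILS. Hence `Ex63.PhiEllSync` is genuine input about `φ^{Θell}_{•,v}` that the interface `PMBaseKit` (v2,
  frozen) does not carry — it can neither be discharged nor refuted over the interface as it stands, and a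
  consumer inside the [IUTchIII] Cor. 3.12 cone must take it BY NAME (plan/GAP-LEDGER discipline, D-0067);
* `DThetaEllBridge.exists_kit_not_xiGroupCompat` — the CONCLUSION itself fails over a kit: with TWO
  valuations (`𝕍 = Bool`, the toy kit at both, `φ^{Θell}_{•,v}` the identity at one and the translation at
  the other) the model `𝒟-Θ^{ell}`-bridge of Example 6.3 (i) has `†ξ^{Θell}_{v_0,w_0} = (z ↦ z − 1)`, which is
  not compatible with the `𝔽_l^±`-group structures. So Prop 6.5 (i), second sentence, AS TYPED over the
  frozen interface, is not derivable from it (R7-L5t4-F1 made kernel-checked), and the synchronisation law is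
  exactly the missing input.

Record only; nothing here takes a side on any disputed step; typed ≠ proved.
-/

namespace Literature.IUT.HodgeTheaters

open CategoryTheory

namespace PMBaseKit

/-- **Ex 6.3 (i)'s synchronisation law holds in the consistency model**: for abc-iut-L5-t4's toy kit
(`φ^{Theta ell}_{•,v}` the identity of `AGL₁(𝔽_l)` on cusps, local charts the sign multiples of the
identity, fixed global chart the identity) every local chart pulls back along `φ^{Θell}_{•,v}` to `±` the
fixed chart. [claim: Mochizuki2012, status: disputed] -/
theorem Ex63.phiEllSync_toyKit (l : ℕ) [Fact l.Prime] (hl : l ≠ 2) :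
    Ex63.PhiEllSync (toyKit l hl) := by
  classical
  rintro v e ⟨ε, rfl⟩
  refine ⟨ε, ?_⟩
  -- both sides are `z ↦ ε • z` on `𝔽_l`
  have hchart : ∀ z : ZMod l, (toyKit l hl).gChart₀ z = z := fun z => by
    change FlPM.toPerm l 1 z = z
    simp
  have hsymm : ∀ z : ZMod l,
      (Equiv.ofBijective _ ((toyKit l hl).labOfHom_phiEll_bijective v)).symm z = (z : ZMod l) :=
    fun z => by
    rw [Equiv.symm_apply_eq]
    change z = (1 : Model.AGL l) • (z : ZMod l)
    rw [one_smul]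
  have key : ∀ z : ZMod l,
      ((Equiv.ofBijective _ ((toyKit l hl).labOfHom_phiEll_bijective v)).symm.trans (signPerm l ε)) z =
        ((toyKit l hl).gChart₀.trans (signPerm l ε)) z := fun z => by
    change (signPerm l ε : Equiv.Perm (ZMod l))
        (((Equiv.ofBijective _ ((toyKit l hl).labOfHom_phiEll_bijective v)).symm z : ZMod l)) =
      (signPerm l ε : Equiv.Perm (ZMod l)) (((toyKit l hl).gChart₀ z : ZMod l))
    rw [hsymm z, hchart z]
  exact Equiv.ext key

/-- **Ex 6.3 (i)'s synchronisation law is independent of the base interface**: for every prime `l ≠ 2`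
there is a kit `K : PMBaseKit l` (with `𝕍 = Unit`; abc-iut-L5-t13's translated toy kit) over which
`Ex63.PhiEllSync K` FAILS — the local chart `id` pulls back along `φ^{Θell}_{•,v} = (z ↦ z + 1)` to
`z ↦ z − 1`, which is not `±` the fixed chart. Consequently the hypothesis of
`DThetaEllBridge.xiGroupCompat_of_sync` cannot be removed over `PMBaseKit` as it stands.
[claim: Mochizuki2012, status: disputed] -/
theorem Ex63.exists_kit_not_phiEllSync (l : ℕ) [Fact l.Prime] (hl : l ≠ 2) :
    ∃ K : PMBaseKit.{0} l, Nonempty K.V ∧ ¬ Ex63.PhiEllSync K := by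
  classical
  -- the translation `z ↦ z + 1` of `AGL₁(𝔽_l)` (as in `Ex63.exists_kit_not_equivariant`)
  let φ₁ : Model.AGL l := ⟨Multiplicative.ofAdd 1, 1⟩
  have hφ₁ : ∀ z : ZMod l, Model.aglPerm l φ₁ z = z + 1 := fun z => by
    change ((1 : (ZMod l)ˣ) : ZMod l) * z + (Multiplicative.ofAdd (1 : ZMod l)).toAdd = z + 1
    simp
  let K : PMBaseKit.{0} l :=
    { PMBaseKit.toyKit l hl with
      phiEll := fun _ => φ₁
      labOfHom_phiEll_bijective := fun _ => (Model.homPerm l (X := .loc) (Y := .glob) φ₁).bijective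
      labOfHom_phiEll_charts := by
        rintro _ e ⟨ε, rfl⟩
        refine ⟨FlPM.mk (-(ε • (1 : ZMod l))) ε, ?_⟩
        ext z
        change (FlPM.mk (l := l) _ ε) • z = ε • (Equiv.ofBijective _ _).symm z
        generalize hw : (Equiv.ofBijective _ _).symm z = w
        rw [Equiv.symm_apply_eq] at hw
        change z = Model.homPerm l (X := .loc) (Y := .glob) φ₁ w at hw
        have hw' : z = w + 1 := by rw [hw]; exact hφ₁ w
        subst hw'
        simp only [FlPM.mk_smul, smul_add]
        abel }
  have hV : Nonempty K.V := ⟨(show K.V from ())⟩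
  refine ⟨K, hV, fun hS => ?_⟩
  obtain ⟨v⟩ := hV
  -- the identity is a local chart of the model at `v`
  have hmem : signPerm l 1 ∈ (K.labPM v (K.model v) ⟨Iso.refl _⟩).charts := ⟨1, rfl⟩
  obtain ⟨ε, hε⟩ := hS v (signPerm l 1) hmem
  -- read both sides at the label `1`: the left side is `0`, the right side is `ε • 1 = ±1`
  have hchart : ∀ z : ZMod l, K.gChart₀ z = z := fun z => by
    change FlPM.toPerm l 1 z = z
    simp
  have hsymm : (Equiv.ofBijective _ (K.labOfHom_phiEll_bijective v)).symm (1 : ZMod l) = (0 : ZMod l) := by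
    rw [Equiv.symm_apply_eq]
    change (1 : ZMod l) = Model.aglPerm l φ₁ 0
    rw [hφ₁, zero_add]
  have h1 := Equiv.congr_fun hε (1 : ZMod l)
  change (signPerm l 1 : Equiv.Perm (ZMod l))
      (((Equiv.ofBijective _ (K.labOfHom_phiEll_bijective v)).symm (1 : ZMod l) : ZMod l)) =
    (signPerm l ε : Equiv.Perm (ZMod l)) ((K.gChart₀ (1 : ZMod l) : ZMod l)) at h1
  rw [hsymm, hchart, signPerm_apply, signPerm_apply, smul_zero] at h1
  -- `h1 : 0 = ε • 1` in `𝔽_l`, i.e. `1 = 0`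
  have h10 : (1 : ZMod l) = 0 := by
    rcases Int.units_eq_one_or ε with rfl | rfl
    · rw [one_smul] at h1
      exact h1.symm
    · rw [Units.neg_smul, one_smul] at h1
      have h1' := congrArg Neg.neg h1
      rw [neg_neg, neg_zero] at h1'
      exact h1'.symm
  have hprime : l.Prime := Fact.out
  have hl1 : l ∣ 1 := (ZMod.natCast_eq_zero_iff 1 l).mp (by exact_mod_cast h10)
  exact hprime.one_lt.ne' (Nat.dvd_one.mp hl1)

end PMBaseKit

/-! ### Prop 6.5 (i), second sentence: not derivable from the base interface -/

namespace PMBaseKit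

/-- **Prop 6.5 (i), second sentence (`DThetaEllBridge.XiGroupCompat`) is independent of the base
interface**: for every prime `l ≠ 2` there is a kit `K : PMBaseKit l` with TWO valuations `𝕍 = Bool`
(abc-iut-L5-t4's toy collage kit at both, with `φ^{Θell}_{•,v}` the identity at one valuation and the
translation `z ↦ z + 1` of `AGL₁(𝔽_l)` at the other — all interface clauses hold) and a `𝒟-Θ^{ell}`-bridge
over it (the model bridge of Example 6.3 (i)) for which `†ξ^{Θell}_{v_0,w_0} = (†ζ^{Θell}_{w_0})⁻¹ ∘ †ζ^{Θell}_{v_0}`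
is the translation `z ↦ z − 1`, NOT compatible with the `𝔽_l^±`-group structures. So the audit finding
R7-L5t4-F1 is sharp: the printed "follows immediately from the definitions" (p. 164) uses the
synchronisation of the `φ^{Θell}_{•,v}` across `v` (Example 6.3 (i), `Ex63.PhiEllSync`), which the frozen
interface does not record. [claim: Mochizuki2012, status: disputed] -/
theorem DThetaEllBridge.exists_kit_not_xiGroupCompat (l : ℕ) [Fact l.Prime] (hl : l ≠ 2) :
    ∃ (K : PMBaseKit.{0} l) (B : K.DThetaEllBridge), ¬ B.XiGroupCompat := by
  classical
  haveI : NeZero l := ⟨(Fact.out : l.Prime).ne_zero⟩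
  -- the translation `z ↦ z + 1` of `AGL₁(𝔽_l)`
  let φ₁ : Model.AGL l := ⟨Multiplicative.ofAdd 1, 1⟩
  have hφ₁ : ∀ z : ZMod l, Model.aglPerm l φ₁ z = z + 1 := fun z => by
    change ((1 : (ZMod l)ˣ) : ZMod l) * z + (Multiplicative.ofAdd (1 : ZMod l)).toAdd = z + 1
    simp
  let T : PMBaseKit.{0} l := PMBaseKit.toyKit l hl
  -- the toy kit at two valuations, `φ^{Θell}` the identity at `true` and the translation at `false`
  let K : PMBaseKit.{0} l :=
    { V := Bool
      bad := ∅
      arc := ∅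
      Amb := fun _ => T.Amb ()
      model := fun _ => T.model ()
      pmObj := fun _ => T.pmObj ()
      toPM := fun _ => T.toPM ()
      LabCuspPM := fun _ => T.LabCuspPM ()
      labPM := fun _ => T.labPM ()
      labMap := fun _ => T.labMap ()
      labMap_refl := fun _ => T.labMap_refl ()
      labMap_trans := fun _ => T.labMap_trans ()
      labMap_charts := fun _ => T.labMap_charts ()
      exists_negative := fun _ => T.exists_negative ()
      Glob := T.Glob
      gModel := T.gModel
      gIso := T.gIso
      GLab := T.GLab
      gLabMap := fun φ => T.gLabMap φ
      gLabMap_refl := T.gLabMap_refl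
      gLabMap_trans := fun φ ψ => T.gLabMap_trans φ ψ
      toFlStar := T.toFlStar
      toFlStar_surjective := T.toFlStar_surjective
      gLabT := T.gLabT
      gChart₀ := T.gChart₀
      gChart₀_mem := T.gChart₀_mem
      autCsp_le := T.autCsp_le
      gLab_range := T.gLab_range
      atV := fun _ => T.atV ()
      phiEll := fun b => bif b then T.phiEll () else (φ₁ : T.model () ⟶ (T.atV ()).obj T.gModel)
      labOfHom := fun _ => T.labOfHom ()
      labOfHom_pre := fun _ => T.labOfHom_pre ()
      labOfHom_post := fun _ => T.labOfHom_post ()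
      labOfHom_phiEll_bijective := fun b => by
        cases b
        · exact (Model.homPerm l (X := .loc) (Y := .glob) φ₁).bijective
        · exact T.labOfHom_phiEll_bijective ()
      labOfHom_phiEll_charts := fun b => by
        cases b
        · rintro e ⟨ε, rfl⟩
          refine ⟨FlPM.mk (-(ε • (1 : ZMod l))) ε, ?_⟩
          ext z
          change (FlPM.mk (l := l) _ ε) • z = ε • (Equiv.ofBijective _ _).symm z
          generalize hw : (Equiv.ofBijective _ _).symm z = w
          rw [Equiv.symm_apply_eq] at hw
          change z = Model.homPerm l (X := .loc) (Y := .glob) φ₁ w at hw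
          have hw' : z = w + 1 := by rw [hw]; exact hφ₁ w
          subst hw'
          simp only [FlPM.mk_smul, smul_add]
          abel
        · exact T.labOfHom_phiEll_charts () }
  let B : K.DThetaEllBridge := Ex63.bridge K
  refine ⟨K, B, fun hX => ?_⟩
  -- the bijections `ζ` at `t = 0` and the two valuations (Prop 6.5 (i), first sentence — proved)
  obtain ⟨ζt, hζt⟩ := DThetaEllBridge.inducesZeta B (0 : ZMod l) true
  obtain ⟨ζf, hζf⟩ := DThetaEllBridge.inducesZeta B (0 : ZMod l) false
  -- `φ^{Θell}_{•,v}` itself is a member of `φ^{Θell}_{v_0}`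
  have hmem : ∀ v : K.V, K.phiEll v ∈ B.poly (0 : ZMod l) v := fun v => by
    change K.phiEll v ∈ Ex63.poly K 0 v
    refine ⟨Iso.refl _, (K.mem_autPlus_iff _).mpr (K.labMap_refl v _), Iso.refl _, ?_, by simp⟩
    rw [Ex63.lifts_transl_zero]
    exact one_mem _
  have hζt' : K.labOfHom true (K.phiEll true) = ⇑ζt := hζt.1 _ (hmem true)
  have hζf' : K.labOfHom false (K.phiEll false) = ⇑ζf := hζf.1 _ (hmem false)
  -- `ζ_true = id`, `ζ_false = (z ↦ z + 1)` on `𝔽_l`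
  have hζt0 : ζt (0 : ZMod l) = (0 : ZMod l) := by
    rw [← hζt']
    change (1 : Model.AGL l) • (0 : ZMod l) = 0
    rw [one_smul]
  have hζf1 : ζf.symm (0 : ZMod l) = (-1 : ZMod l) := by
    rw [Equiv.symm_apply_eq]
    change (0 : ZMod l) = ζf (-1 : ZMod l)
    rw [← hζf']
    change (0 : ZMod l) = Model.aglPerm l φ₁ (-1)
    rw [hφ₁, neg_add_cancel]
  -- the identity is a chart of `LabCusp^±(†𝒟_{w_0})`; compatibility would make `ξ = z ↦ z − 1` a sign
  have hC := hX (0 : ZMod l) true false ζt ζf hζt hζf (signPerm l 1) ⟨1, rfl⟩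
  obtain ⟨ε, hε⟩ := hC
  have h0 := Equiv.congr_fun hε (0 : ZMod l)
  change ε • (0 : ZMod l) = signPerm l 1 (ζf.symm (ζt (0 : ZMod l))) at h0
  rw [hζt0, hζf1, smul_zero, signPerm_apply, one_smul] at h0
  -- `h0 : 0 = -1` in `𝔽_l`
  have h10 : (1 : ZMod l) = 0 := by
    have := congrArg Neg.neg h0
    rw [neg_zero, neg_neg] at this
    exact this.symm
  have hprime : l.Prime := Fact.out
  have hl1 : l ∣ 1 := (ZMod.natCast_eq_zero_iff 1 l).mp (by exact_mod_cast h10)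
  exact hprime.one_lt.ne' (Nat.dvd_one.mp hl1)

end PMBaseKit

end Literature.IUT.HodgeTheaters
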